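import Summits.QuantumAdvantage.QuantumAdvantage.Theorems.CharDialSegmentMovesF
import HarnessLib

/-!
# CharDial — segment moves, part G: the Young slice meets the HIGH side outside the proved rank dial

Support for `CharDial.WalkHardFJLinOdd` (stmt-QuantumAdvantage-32604), continuing part F.  The comb family is a class-non-containment
witness, not a hard-looking instance; the typed target it points at is the **Young slice** of the blocker: junta ⊕ form data whose every form
is a scalar multiple of the indicator of ONE class of a class assignment `π : Fin n → Fin B` (each cut reads `u_J` and ONE class popcount
mod `p`).  This part records, Prop-free: the class-indicator form identity `form_young` (`⟨λ·1_{π = β}, u⟩ = λ·#{i : π i = β ∧ u_i}`), the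
side-information SIMULATION identity `strat_eq_of_young` (a Young datum's strategy is the log-junta strategy that additionally sees the vector
`classRes p π u` of class popcounts mod `p` — the reduction «side-information hardness ⇒ Young slice»), the membership of the comb family in
the Young slice over the comb assignment `i ↦ i mod B` with classes of size `≥ youngM p n = p(8 log₂ n + 9) − 1` (`combData_young`,
`card_young_comb_ge`), and ★ `youngSlice_meets_highOpen`: for every prime `p` and all large `n` the Young slice at class size `youngM` contains
an empty-junta datum on the HIGH side of the variation dial (threshold `4(log₂ n + 1)`) NO re-presentation of which with juntas `≤ log₂ n` meets
the span hypothesis of `cubeRank_hard`.  The slice itself (as a hardness statement) is typed in the OrbitDial annex, not here; nothing about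
its truth is claimed.
-/

set_option autoImplicit false

namespace Summit.QuantumAdvantage.AdviceFreeQNC0.JLinPeel.SegMove

open Finset
open Summit.QuantumAdvantage.AdviceFreeQNC0

variable {n : ℕ} {p : ℕ}

/-- the value of a class-indicator form: `⟨λ·1_{π = β}, u⟩ = λ · #{i : π i = β ∧ u_i}`. -/
theorem form_young {B : ℕ} (π : Fin n → Fin B) (β : Fin B) (l : ZMod p) (u : Fin n → Bool) :
    form (fun i => if π i = β then l else 0) u = l * ((univ.filter fun i : Fin n => π i = β ∧ u i = true).card : ZMod p) := by
  unfold form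
  rw [Finset.natCast_card_filter, Finset.mul_sum]
  refine Finset.sum_congr rfl fun i _ => ?_
  by_cases hu : u i = true
  · by_cases hπ : π i = β
    · simp [hu, hπ]
    · simp [hu, hπ]
  · simp [hu]

/-- the vector of class popcounts mod `p` of a class assignment (the side information). -/
def classRes {B : ℕ} (p : ℕ) (π : Fin n → Fin B) (u : Fin n → Bool) : Fin B → ZMod p :=
  fun b => ((univ.filter fun i : Fin n => π i = b ∧ u i = true).card : ZMod p)

/-- **simulation identity.** a Young datum (cut `g`'s form = `l g` times the indicator of class `β g`) presents EXACTLY the log-junta strategy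
that additionally sees the class popcounts mod `p` and feeds `l g · (classRes p π u) (β g)` to its table. -/
theorem strat_eq_of_young {B : ℕ} (π : Fin n → Fin B) (D : JLinData p n) (β : Fin (n + 1) → Fin B) (l : Fin (n + 1) → ZMod p)
    (hβl : ∀ g, D.a g = fun i => if π i = β g then l g else 0) :
    (fun g u => D.h g u (l g * classRes p π u (β g))) = D.strat := by
  funext g u
  show D.h g u (l g * classRes p π u (β g)) = D.h g u (form (D.a g) u)
  rw [hβl g, form_young]
  rfl

/-- the class-size schedule at which the comb family lies in the Young slice: `p(8 log₂ n + 9) − 1`. -/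
def youngM (p n : ℕ) : ℕ := combK p n - 1

/-- **the comb family is Young** over the comb assignment `i ↦ i mod B` (every cut's form is `1` or `0` times one class indicator). -/
theorem combData_young (hB : 0 < combB p n) : ∀ g : Fin (n + 1), ∃ β : Fin (combB p n), ∃ l : ZMod p,
    (combData p n).a g = fun i => if (⟨i.val % combB p n, Nat.mod_lt _ hB⟩ : Fin (combB p n)) = β then l else 0 := by
  intro g
  by_cases hg : g.val / combK p n < combB p n
  · refine ⟨⟨g.val / combK p n, hg⟩, 1, ?_⟩
    funext i
    show combCoef p (combB p n) (g.val / combK p n) i = _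
    unfold combCoef
    simp [Fin.ext_iff]
  · refine ⟨⟨0, hB⟩, 0, ?_⟩
    funext i
    show combCoef p (combB p n) (g.val / combK p n) i = _
    unfold combCoef
    have : i.val % combB p n ≠ g.val / combK p n := fun h => hg (h ▸ Nat.mod_lt _ hB)
    simp [this]

/-- the comb classes have `≥ youngM p n` elements. -/
theorem card_young_comb_ge (hB : 0 < combB p n) (b : Fin (combB p n)) :
    youngM p n ≤ (univ.filter fun i : Fin n => (⟨i.val % combB p n, Nat.mod_lt _ hB⟩ : Fin (combB p n)) = b).card := by
  have h1 : (univ.filter fun i : Fin n => (⟨i.val % combB p n, Nat.mod_lt _ hB⟩ : Fin (combB p n)) = b) =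
      combClass n (combB p n) b.val := by
    unfold combClass; ext i; simp [Fin.ext_iff]
  rw [h1]
  refine le_trans ?_ (card_combClass_ge hB b.isLt)
  have h2 : (combK p n - 1) * combB p n = combK p n * combB p n - combB p n := Nat.sub_one_mul _ _
  have h3 : combK p n * combB p n ≤ n + 1 := by rw [Nat.mul_comm]; exact combB_mul_le p n
  unfold youngM
  rw [Nat.le_div_iff_mul_le hB, h2]
  omega

/-- ★ **the Young slice meets HIGH outside the proved rank dial** (Prop-free form).  For every prime `p` and all large `n`: a class
assignment with all classes of size `≥ youngM p n`, and over it a Young datum `D` with EMPTY juntas presenting a strategy that satisfies the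
blocker's hypothesis, lies on the HIGH side of the variation dial at threshold `4(log₂ n + 1)`, and NO junta ⊕ form re-presentation of which
with juntas `≤ log₂ n` meets the span hypothesis of `cubeRank_hard`. -/
theorem youngSlice_meets_highOpen (p : ℕ) [hp : Fact p.Prime] : ∃ n₁, ∀ n ≥ n₁,
    ∃ (B : ℕ) (π : Fin n → Fin B), (∀ b, youngM p n ≤ (univ.filter fun i : Fin n => π i = b).card) ∧
      ∃ D : JLinData p n, (∀ g, ∃ β : Fin B, ∃ l : ZMod p, D.a g = fun i => if π i = β then l else 0) ∧
        (∀ g, (D.J g).card ≤ Nat.log 2 n) ∧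
        (∀ g : Fin (n + 1), ∃ J : Finset (Fin n), J.card ≤ Nat.log 2 n ∧ ∃ a : Fin n → ZMod p,
          ∃ h : (Fin n → Bool) → ZMod p → Bool, (∀ u v : Fin n → Bool, (∀ i ∈ J, u i = v i) → ∀ s, h u s = h v s) ∧
            ∀ u, D.strat g u = h u (∑ i, if u i then a i else 0)) ∧
        ¬ (n ≤ 2 * (lowPositions n D.strat (4 * (Nat.log 2 n + 1))).card) ∧
        ∀ D' : JLinData p n, D'.strat = D.strat → (∀ g, (D'.J g).card ≤ Nat.log 2 n) →
          ¬ ∃ A : Fin (cubeRate n) → Fin n → ZMod p,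
            ∀ g, ¬ (∀ (u : Fin n → Bool) (s s' : ZMod p), D'.h g u s = D'.h g u s') →
              ∃ l : Fin (cubeRate n) → ZMod p, D'.a g = fun i => ∑ j, l j * A j i := by
  have hp0 : 0 < p := hp.out.pos
  obtain ⟨n₁, hn₁⟩ := eventually_mul_log_le (18 * p)
  obtain ⟨n₂, hn₂⟩ := highOpen_inhabited p
  refine ⟨max n₁ n₂, fun n hn => ?_⟩
  have h1 := hn₁ n (le_trans (le_max_left _ _) hn)
  obtain ⟨hhigh, hesc⟩ := hn₂ n (le_trans (le_max_right _ _) hn)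
  have hK0 : 0 < combK p n := combK_pos n
  have hB2 : 2 ≤ combB p n := by
    unfold combB
    rw [Nat.le_div_iff_mul_le hK0]
    have : combK p n = p * (8 * Nat.log 2 n + 9) := rfl
    nlinarith
  have hB : 0 < combB p n := by omega
  refine ⟨combB p n, fun i => ⟨i.val % combB p n, Nat.mod_lt _ hB⟩, card_young_comb_ge hB, combData p n,
    combData_young hB, fun g => by simp [combData], fun g => ⟨(combData p n).J g, by simp [combData], (combData p n).a g,
      (combData p n).h g, (combData p n).hJ g, fun _ => rfl⟩, hhigh, fun D' hD' hJ' => hesc D' hD' hJ'⟩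

end Summit.QuantumAdvantage.AdviceFreeQNC0.JLinPeel.SegMove
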